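import Mathlib
import HarnessLib
import Summits.PneNP.Statement
import Literature.Computability.Complexity.CNF
import Literature.Computability.Complexity.PNPWave0
import Literature.Computability.Complexity.Classes
import Literature.Computability.Complexity.BoolEncodings

/-!
# PneNP / OverlapGapAlgebra — support item `StableSectionEasyRegime` (stmt-PneNP-2467)

Route `PneNP/OverlapGapAlgebra`, support item stmt-PneNP-2467 (`StableSectionEasyRegime`, rank 9):
for all `η, ν > 0` there is `k₀` such that for every `k ≥ k₀`, every density `0 < α ≤ 2^k/k`,
every `c > 0` and all large `n` (with `m = ⌊α n⌋₊` clauses) SOME map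
`g : (Fin m → Fin k → Fin n × Bool) → (Fin n → Bool)` is `ν`-valid (at most `ν m` violated
clauses) at all `k·(mk)+k` splice points of the Bresler–Huang literal-resampling path and moves by
at most `η n` (Hamming) between consecutive splice points, on at least an `e^{-cn}` fraction of the
path tuples `Ψ : Fin (k+1) → Fin m → Fin k → Fin n × Bool`.

## Proof (elementary; the statement as typed is much weaker than the intended calibration)

The item's docstring suggests local algorithms (Bresler–Huang Thm 2.13–2.14).  As TYPED, however,
`g` ranges over ALL maps and validity only asks for `≤ ν m` violated clauses with `ν` fixed BEFORE
`k`, so the CONSTANT section `g ≡ (fun _ => true)` already works, at every density (the hypothesis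
`α ≤ 2^k/k` is not needed):

* stability is free (`hammingDist x x = 0`);
* under the all-`true` assignment a clause is violated iff all its `k` literals are negative; along
  the path the instance at splice point `(r, q)` takes each clause entirely from `Ψ r.succ` or
  entirely from `Ψ r.castSucc`, except the at most one clause straddling position `q`; hence the
  number of violated clauses at `(r, q)` is at most `W (Ψ r.succ) + W (Ψ r.castSucc) + 1`, where
  `W Φ = #{i | clause i of Φ is all-negative}`;
* first moment: `∑_Φ W Φ = m · #Φ / 2^k` exactly (a fibre count on the product space), so by
  Markov at most a `3/(ν 2^k)` fraction of instances `Φ` have `W Φ > ν m / 3`;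
* the product set `{Ψ | ∀ ρ, W (Ψ ρ) ≤ ν m/3}` has density `≥ (1 - 3/(ν 2^k))^{k+1} ≥
  1 - 3(k+1)/(ν 2^k) ≥ 1/2` (Bernoulli) once `6(k+1) ≤ ν 2^k`, i.e. for `k ≥ k₀(ν)`, and on it
  every splice point has at most `ν m/3 + ν m/3 + 1 ≤ ν m` violated clauses as soon as `ν m ≥ 3`;
* finally `e^{-cn} ≤ 1/2` for `n ≥ log 2 / c`.

So the typed item is TRUE but carries no information about algorithms: it is closed here as
stated; the planner may want a sharper calibration item (e.g. `ν = ν(k) < 2^{-k}`, or exact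
satisfaction `ν = 0` below `2^k/k`), which would need the local-algorithm analysis.

The theorem is stated STRUCTURALLY (verbatim body of the route decl) and this file deliberately does
NOT import the route file `Summits.PneNP.PneNP.Theses.OverlapGapAlgebra`, so that the gate can link
`StableSectionEasyRegime_holds` by importing this module into the route file without an import
cycle; imports and `open`s mirror the route file so that the statement elaborates to the same term.

References: G. Bresler, B. Huang, *The algorithmic phase transition of random k-SAT for low degree
polynomials*, FOCS 2021 / arXiv:2106.02129, Def. 2.1, Def. 4.2 (model and path only).
-/

set_option linter.dupNamespace false -- `Summit.PneNP.PneNP.…`: summit = sub-problem (D-0017)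

namespace Summit.PneNP.PneNP.Theorems

open scoped BigOperators Topology Manifold Classical MeasureTheory ProbabilityTheory Matrix InnerProductSpace ComplexConjugate ContinuousMap
open Filter Set Function TopologicalSpace MeasureTheory

/-- Literals with a negative sign: `#{x : Fin n × Bool | x.2 = false} = n`. -/
theorem ssER_card_negLiterals (n : ℕ) :
    ((Finset.univ : Finset (Fin n × Bool)).filter fun x => x.2 = false).card = n := by
  have h : ((Finset.univ : Finset (Fin n × Bool)).filter fun x => x.2 = false)
      = (Finset.univ : Finset (Fin n)) ×ˢ ({false} : Finset Bool) := by
    ext ⟨v, b⟩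
    simp
  rw [h, Finset.card_product, Finset.card_singleton, Finset.card_univ, Fintype.card_fin, mul_one]

/-- All-negative clauses are a `2^{-k}` fraction of all clauses:
`#{cl : Fin k → Fin n × Bool | ∀ j, (cl j).2 = false} · 2^k = #(Fin k → Fin n × Bool)`. -/
theorem ssER_card_badClauses (n k : ℕ) :
    ((Finset.univ : Finset (Fin k → Fin n × Bool)).filter fun cl => ∀ j, (cl j).2 = false).card
        * 2 ^ k = Fintype.card (Fin k → Fin n × Bool) := by
  have h : ((Finset.univ : Finset (Fin k → Fin n × Bool)).filter fun cl => ∀ j, (cl j).2 = false)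
      = Fintype.piFinset fun _ : Fin k =>
          (Finset.univ : Finset (Fin n × Bool)).filter fun x => x.2 = false := by
    ext cl
    simp [Fintype.mem_piFinset]
  rw [h, Fintype.card_piFinset_const, ssER_card_negLiterals, Fintype.card_pi_const,
    Fintype.card_prod, Fintype.card_fin, Fintype.card_bool, mul_pow]

/-- Fibre count on a product space: `#{f : ι → C | f i ∈ B} = #B · #C ^ (#ι - 1)`. -/
theorem ssER_card_fiber {ι C : Type*} [Fintype ι] [DecidableEq ι] [Fintype C] [DecidableEq C]
    (B : Finset C) (i : ι) :
    ((Finset.univ : Finset (ι → C)).filter fun f => f i ∈ B).card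
      = B.card * Fintype.card C ^ (Fintype.card ι - 1) := by
  have h := Fintype.piFinset_update_eq_filter_piFinset_mem
    (fun _ : ι => (Finset.univ : Finset C)) i (t := B) (Finset.subset_univ _)
  rw [Fintype.piFinset_univ] at h
  rw [← h, Fintype.card_piFinset, ← Finset.mul_prod_erase Finset.univ _ (Finset.mem_univ i),
    Function.update_self]
  have hc : ∀ j ∈ Finset.univ.erase i,
      (Function.update (fun _ : ι => (Finset.univ : Finset C)) i B j).card = Fintype.card C := by
    intro j hj
    rw [Function.update_of_ne (Finset.ne_of_mem_erase hj), Finset.card_univ]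
  rw [Finset.prod_congr rfl hc, Finset.prod_const, Finset.card_erase_of_mem (Finset.mem_univ i),
    Finset.card_univ]

/-- Markov's inequality, counting form: `t · #{a ∈ s | t < f a} ≤ ∑_{a ∈ s} f a` for `f ≥ 0`. -/
theorem ssER_markov {α : Type*} (s : Finset α) (f : α → ℕ) (t : ℝ) :
    t * ((s.filter fun a => t < (f a : ℝ)).card : ℝ) ≤ ∑ a ∈ s, (f a : ℝ) := by
  calc t * ((s.filter fun a => t < (f a : ℝ)).card : ℝ)
        = ∑ a ∈ s.filter (fun a => t < (f a : ℝ)), t := by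
          rw [Finset.sum_const, nsmul_eq_mul, mul_comm]
    _ ≤ ∑ a ∈ s.filter (fun a => t < (f a : ℝ)), (f a : ℝ) :=
          Finset.sum_le_sum fun a ha => ((Finset.mem_filter.1 ha).2).le
    _ ≤ ∑ a ∈ s, (f a : ℝ) :=
          Finset.sum_le_sum_of_subset_of_nonneg (Finset.filter_subset _ _)
            fun _ _ _ => Nat.cast_nonneg _

/-- First moment of the number `W Φ` of all-negative clauses of an instance `Φ`:
`(∑_Φ W Φ) · 2^k = m · #(instances)`. -/
theorem ssER_sum_allNeg (n k m : ℕ) :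
    (∑ Φ : Fin m → Fin k → Fin n × Bool,
        ((Finset.univ : Finset (Fin m)).filter fun i : Fin m => ∀ j, (Φ i j).2 = false).card) * 2 ^ k
      = m * Fintype.card (Fin m → Fin k → Fin n × Bool) := by
  have hW : ∀ Φ : Fin m → Fin k → Fin n × Bool,
      ((Finset.univ : Finset (Fin m)).filter fun i : Fin m => ∀ j, (Φ i j).2 = false).card
        = ∑ i : Fin m, if Φ i ∈ ((Finset.univ : Finset (Fin k → Fin n × Bool)).filter
            fun cl => ∀ j, (cl j).2 = false) then 1 else 0 := by
    intro Φ
    rw [Finset.card_filter]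
    refine Finset.sum_congr rfl fun i _ => ?_
    simp
  have hfib : ∀ i : Fin m, (∑ Φ : Fin m → Fin k → Fin n × Bool,
      if Φ i ∈ ((Finset.univ : Finset (Fin k → Fin n × Bool)).filter
            fun cl => ∀ j, (cl j).2 = false) then 1 else 0)
        = (((Finset.univ : Finset (Fin k → Fin n × Bool)).filter
            fun cl => ∀ j, (cl j).2 = false)).card
          * Fintype.card (Fin k → Fin n × Bool) ^ (m - 1) := by
    intro i
    rw [← Finset.card_filter, ssER_card_fiber, Fintype.card_fin]
  calc (∑ Φ : Fin m → Fin k → Fin n × Bool,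
        ((Finset.univ : Finset (Fin m)).filter fun i : Fin m => ∀ j, (Φ i j).2 = false).card) * 2 ^ k
      = (∑ Φ : Fin m → Fin k → Fin n × Bool, ∑ i : Fin m,
          if Φ i ∈ ((Finset.univ : Finset (Fin k → Fin n × Bool)).filter
            fun cl => ∀ j, (cl j).2 = false) then 1 else 0) * 2 ^ k := by
        simp only [hW]
    _ = (∑ i : Fin m, ∑ Φ : Fin m → Fin k → Fin n × Bool,
          if Φ i ∈ ((Finset.univ : Finset (Fin k → Fin n × Bool)).filter
            fun cl => ∀ j, (cl j).2 = false) then 1 else 0) * 2 ^ k := by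
        rw [Finset.sum_comm]
    _ = m * ((((Finset.univ : Finset (Fin k → Fin n × Bool)).filter
            fun cl => ∀ j, (cl j).2 = false)).card * 2 ^ k
          * Fintype.card (Fin k → Fin n × Bool) ^ (m - 1)) := by
        simp only [hfib, Finset.sum_const, Finset.card_univ, Fintype.card_fin, smul_eq_mul]
        ring
    _ = m * Fintype.card (Fin m → Fin k → Fin n × Bool) := by
        rw [ssER_card_badClauses]
        rcases Nat.eq_zero_or_pos m with rfl | hm
        · simp
        · rw [Fintype.card_pi_const (Fin k → Fin n × Bool) m, ← pow_succ', Nat.sub_add_cancel hm]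

/-- Good instances are most instances: at least a `1 - 3/(ν 2^k)` fraction of the instances
`Φ : Fin m → Fin k → Fin n × Bool` have at most `ν m / 3` all-negative clauses (`m > 0`). -/
theorem ssER_good_instances (n k m : ℕ) (ν : ℝ) (hν : 0 < ν) (hm : 0 < m) :
    (1 - 3 / (ν * 2 ^ k)) * Fintype.card (Fin m → Fin k → Fin n × Bool)
      ≤ (((Finset.univ : Finset (Fin m → Fin k → Fin n × Bool)).filter fun Φ =>
          ((((Finset.univ : Finset (Fin m)).filter fun i : Fin m => ∀ j, (Φ i j).2 = false).card : ℝ)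
            ≤ ν * m / 3)).card : ℝ) := by
  -- notation-free abbreviations
  set N : ℕ := Fintype.card (Fin m → Fin k → Fin n × Bool) with hN
  set W : (Fin m → Fin k → Fin n × Bool) → ℕ := fun Φ =>
    ((Finset.univ : Finset (Fin m)).filter fun i : Fin m => ∀ j, (Φ i j).2 = false).card with hWdef
  have hsum : (∑ Φ : Fin m → Fin k → Fin n × Bool, (W Φ : ℝ)) * 2 ^ k = m * N := by
    have := ssER_sum_allNeg n k m
    rw [← hN] at this
    exact_mod_cast this
  have hmarkov := ssER_markov (Finset.univ : Finset (Fin m → Fin k → Fin n × Bool)) W (ν * m / 3)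
  have hsplit := Finset.card_filter_add_card_filter_not
    (s := (Finset.univ : Finset (Fin m → Fin k → Fin n × Bool))) (fun Φ => (W Φ : ℝ) ≤ ν * m / 3)
  rw [Finset.card_univ, ← hN] at hsplit
  have hneg : ((Finset.univ : Finset (Fin m → Fin k → Fin n × Bool)).filter
      fun Φ => ¬ ((W Φ : ℝ) ≤ ν * m / 3))
        = (Finset.univ.filter fun Φ => ν * m / 3 < (W Φ : ℝ)) := by
    simp only [not_le]
  rw [hneg] at hsplit
  have hmR : (0 : ℝ) < m := by exact_mod_cast hm
  have h2k : (0 : ℝ) < 2 ^ k := by positivity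
  -- the bad instances are few
  have hbad : (((Finset.univ : Finset (Fin m → Fin k → Fin n × Bool)).filter
      fun Φ => ν * m / 3 < (W Φ : ℝ)).card : ℝ) ≤ 3 * N / (ν * 2 ^ k) := by
    rw [le_div_iff₀ (by positivity)]
    calc (((Finset.univ : Finset (Fin m → Fin k → Fin n × Bool)).filter
            fun Φ => ν * m / 3 < (W Φ : ℝ)).card : ℝ) * (ν * 2 ^ k)
          = 3 / m * (ν * m / 3 * (((Finset.univ : Finset (Fin m → Fin k → Fin n × Bool)).filter
              fun Φ => ν * m / 3 < (W Φ : ℝ)).card : ℝ)) * 2 ^ k := by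
            field_simp
      _ ≤ 3 / m * (∑ Φ : Fin m → Fin k → Fin n × Bool, (W Φ : ℝ)) * 2 ^ k := by
            gcongr
      _ = 3 / m * ((∑ Φ : Fin m → Fin k → Fin n × Bool, (W Φ : ℝ)) * 2 ^ k) := by ring
      _ = 3 * N := by rw [hsum]; field_simp
  have hsplitR : ((((Finset.univ : Finset (Fin m → Fin k → Fin n × Bool)).filter
      fun Φ => (W Φ : ℝ) ≤ ν * m / 3)).card : ℝ)
        + (((Finset.univ : Finset (Fin m → Fin k → Fin n × Bool)).filter
            fun Φ => ν * m / 3 < (W Φ : ℝ)).card : ℝ) = N := by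
    exact_mod_cast hsplit
  have hδN : (1 - 3 / (ν * 2 ^ k)) * (N : ℝ) = N - 3 * N / (ν * 2 ^ k) := by ring
  rw [hδN]
  linarith

/-- The good PRODUCT set is at least half of all path tuples once `6(k+1) ≤ ν 2^k`:
`#Ψ / 2 ≤ #{Ψ | ∀ ρ, W (Ψ ρ) ≤ ν m/3}` (Bernoulli's inequality on the `(k+1)`-fold product). -/
theorem ssER_good_paths (n k m : ℕ) (ν : ℝ) (hν : 0 < ν) (hm : 0 < m)
    (hk : ((k : ℝ) + 1) * (3 / (ν * 2 ^ k)) ≤ 1 / 2) :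
    (1 / 2 : ℝ) * Fintype.card (Fin (k + 1) → Fin m → Fin k → Fin n × Bool)
      ≤ ((Fintype.piFinset fun _ : Fin (k + 1) =>
          ((Finset.univ : Finset (Fin m → Fin k → Fin n × Bool)).filter fun Φ =>
            ((((Finset.univ : Finset (Fin m)).filter fun i : Fin m => ∀ j, (Φ i j).2 = false).card : ℝ)
              ≤ ν * m / 3))).card : ℝ) := by
  set good := ((Finset.univ : Finset (Fin m → Fin k → Fin n × Bool)).filter fun Φ =>
    ((((Finset.univ : Finset (Fin m)).filter fun i : Fin m => ∀ j, (Φ i j).2 = false).card : ℝ)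
      ≤ ν * m / 3)) with hgood_def
  set N : ℕ := Fintype.card (Fin m → Fin k → Fin n × Bool) with hN
  have hgood : (1 - 3 / (ν * 2 ^ k)) * (N : ℝ) ≤ good.card := by
    have := ssER_good_instances n k m ν hν hm
    rw [← hN] at this
    exact this
  set δ : ℝ := 3 / (ν * 2 ^ k) with hδ
  have hδ0 : 0 ≤ δ := by positivity
  have hk1 : (1 : ℝ) ≤ (k : ℝ) + 1 := by
    have : (0 : ℝ) ≤ k := Nat.cast_nonneg k
    linarith
  have hδle : δ ≤ 1 / 2 := le_trans (by nlinarith) hk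
  have h1δ : 0 ≤ 1 - δ := by linarith
  have hpath : (Fintype.card (Fin (k + 1) → Fin m → Fin k → Fin n × Bool) : ℝ) = (N : ℝ) ^ (k + 1) := by
    rw [hN, Fintype.card_pi_const (Fin m → Fin k → Fin n × Bool) (k + 1)]
    push_cast
    ring
  have hG : ((Fintype.piFinset fun _ : Fin (k + 1) => good).card : ℝ) = (good.card : ℝ) ^ (k + 1) := by
    rw [Fintype.card_piFinset_const]
    push_cast
    ring
  rw [hpath, hG]
  have hbern : 1 + ((k + 1 : ℕ) : ℝ) * (-δ) ≤ (1 + (-δ)) ^ (k + 1) :=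
    one_add_mul_le_pow (by linarith) (k + 1)
  have hNk : (0 : ℝ) ≤ (N : ℝ) ^ (k + 1) := by positivity
  calc (1 / 2 : ℝ) * (N : ℝ) ^ (k + 1)
      ≤ (1 + ((k + 1 : ℕ) : ℝ) * (-δ)) * (N : ℝ) ^ (k + 1) := by
        apply mul_le_mul_of_nonneg_right _ hNk
        push_cast
        linarith
    _ ≤ (1 + (-δ)) ^ (k + 1) * (N : ℝ) ^ (k + 1) := mul_le_mul_of_nonneg_right hbern hNk
    _ = ((1 - δ) * N) ^ (k + 1) := by rw [mul_pow]; ring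
    _ ≤ (good.card : ℝ) ^ (k + 1) := pow_le_pow_left₀ (mul_nonneg h1δ (Nat.cast_nonneg _)) hgood _

/-- At most one clause straddles position `q` of the lexicographic literal order:
`#{i : Fin m | i·k < q < i·k + k} ≤ 1`. -/
theorem ssER_straddle_card_le_one (m k q : ℕ) :
    ((Finset.univ : Finset (Fin m)).filter fun i : Fin m => (i : ℕ) * k < q ∧ q < (i : ℕ) * k + k).card
      ≤ 1 := by
  refine Finset.card_le_one.2 fun a ha b hb => ?_
  simp only [Finset.mem_filter, Finset.mem_univ, true_and] at ha hb
  apply Fin.ext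
  have h1 : (a : ℕ) < (b : ℕ) + 1 :=
    Nat.lt_of_mul_lt_mul_right (a := k) (by rw [Nat.add_mul, Nat.one_mul]; omega)
  have h2 : (b : ℕ) < (a : ℕ) + 1 :=
    Nat.lt_of_mul_lt_mul_right (a := k) (by rw [Nat.add_mul, Nat.one_mul]; omega)
  omega

/-- Validity of the constant all-`true` section at splice point `(r, q)`: if every array `Ψ ρ`
has at most `ν m / 3` all-negative clauses and `ν m ≥ 3`, the spliced instance has at most `ν m`
clauses violated by the all-`true` assignment. -/
theorem ssER_validity {n k m : ℕ} (Ψ : Fin (k + 1) → Fin m → Fin k → Fin n × Bool)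
    (r : Fin k) (q : ℕ) (ν : ℝ)
    (hW : ∀ ρ : Fin (k + 1),
      ((((Finset.univ : Finset (Fin m)).filter fun i : Fin m => ∀ j, (Ψ ρ i j).2 = false).card : ℝ)
        ≤ ν * m / 3))
    (h3 : (1 : ℝ) ≤ ν * m / 3) :
    (((Finset.univ : Finset (Fin m)).filter fun i : Fin m => ∀ j : Fin k,
        true ≠ (if (i : ℕ) * k + (j : ℕ) < q then Ψ r.succ i j else Ψ r.castSucc i j).2).card : ℝ)
      ≤ ν * m := by
  have hb : ∀ b : Bool, true ≠ b → b = false := by decide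
  have hsub : ((Finset.univ : Finset (Fin m)).filter fun i : Fin m => ∀ j : Fin k,
        true ≠ (if (i : ℕ) * k + (j : ℕ) < q then Ψ r.succ i j else Ψ r.castSucc i j).2)
      ⊆ ((Finset.univ : Finset (Fin m)).filter fun i : Fin m => ∀ j, (Ψ r.succ i j).2 = false)
        ∪ ((Finset.univ : Finset (Fin m)).filter fun i : Fin m => ∀ j, (Ψ r.castSucc i j).2 = false)
        ∪ ((Finset.univ : Finset (Fin m)).filter
            fun i : Fin m => (i : ℕ) * k < q ∧ q < (i : ℕ) * k + k) := by
    intro i hi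
    simp only [Finset.mem_filter, Finset.mem_univ, true_and] at hi
    simp only [Finset.mem_union, Finset.mem_filter, Finset.mem_univ, true_and]
    by_cases h1 : (i : ℕ) * k + k ≤ q
    · refine Or.inl (Or.inl fun j => ?_)
      have hlt : (i : ℕ) * k + (j : ℕ) < q := by have := j.isLt; omega
      have := hi j
      rw [if_pos hlt] at this
      exact hb _ this
    · by_cases h2 : q ≤ (i : ℕ) * k
      · refine Or.inl (Or.inr fun j => ?_)
        have hnlt : ¬ ((i : ℕ) * k + (j : ℕ) < q) := by omega
        have := hi j
        rw [if_neg hnlt] at this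
        exact hb _ this
      · exact Or.inr ⟨by omega, by omega⟩
  have hcard := Finset.card_le_card hsub
  have hu := (Finset.card_union_le _ _).trans
    (Nat.add_le_add (Finset.card_union_le
      ((Finset.univ : Finset (Fin m)).filter fun i : Fin m => ∀ j, (Ψ r.succ i j).2 = false)
      ((Finset.univ : Finset (Fin m)).filter fun i : Fin m => ∀ j, (Ψ r.castSucc i j).2 = false))
      (ssER_straddle_card_le_one m k q))
  have hle := hcard.trans hu
  have hleR : (((Finset.univ : Finset (Fin m)).filter fun i : Fin m => ∀ j : Fin k,
        true ≠ (if (i : ℕ) * k + (j : ℕ) < q then Ψ r.succ i j else Ψ r.castSucc i j).2).card : ℝ)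
      ≤ (((Finset.univ : Finset (Fin m)).filter fun i : Fin m => ∀ j, (Ψ r.succ i j).2 = false).card : ℝ)
        + (((Finset.univ : Finset (Fin m)).filter fun i : Fin m => ∀ j, (Ψ r.castSucc i j).2 = false).card : ℝ)
        + 1 := by
    exact_mod_cast hle
  have := hW r.succ
  have := hW r.castSucc
  linarith

/-- A threshold `k₀ = k₀(ν)` beyond which `6(k+1) ≤ ν 2^k`, from `(k+1)/2^(k+1) → 0`. -/
theorem ssER_exists_k0 (ν : ℝ) (hν : 0 < ν) :
    ∃ k₀ : ℕ, ∀ k ≥ k₀, ((k : ℝ) + 1) * (3 / (ν * 2 ^ k)) ≤ 1 / 2 := by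
  have h := (tendsto_pow_const_div_const_pow_of_one_lt 1 (one_lt_two (α := ℝ))).comp
    (tendsto_add_atTop_nat 1)
  have hev := h.eventually (gt_mem_nhds (show (0 : ℝ) < ν / 12 by positivity))
  obtain ⟨k₀, hk₀⟩ := Filter.eventually_atTop.1 hev
  refine ⟨k₀, fun k hk => ?_⟩
  have h1 := hk₀ k hk
  simp only [Function.comp, pow_one, Nat.cast_add, Nat.cast_one] at h1
  -- h1 : ((k:ℝ) + 1) / 2 ^ (k + 1) < ν / 12
  have h2k : (0 : ℝ) < 2 ^ k := by positivity
  rw [pow_succ, div_lt_iff₀ (by positivity)] at h1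
  rw [mul_div_assoc', div_le_iff₀ (by positivity)]
  nlinarith

/-- **`StableSectionEasyRegime` holds** (route `OverlapGapAlgebra`, item stmt-PneNP-2467), stated
structurally (verbatim body of the route decl): for all `η, ν > 0` there is `k₀` such that for all
`k ≥ k₀`, `0 < α ≤ 2^k/k`, `c > 0` and eventually all `n`, with `m = ⌊α n⌋₊`, some section `g` is
`ν`-valid at every splice point of the Bresler–Huang path and `η n`-stable between consecutive
splice points on at least `e^{-cn} · #Ψ` path tuples.  Witness: the constant section
`g = fun _ _ => true` (see the module docstring). [BreslerHuang2022, Def. 2.1, Def. 4.2 (model)] -/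
theorem stableSectionEasyRegime_proof :
    ∀ η ν : ℝ, 0 < η → 0 < ν → ∃ k₀ : ℕ, ∀ k ≥ k₀, ∀ α : ℝ, 0 < α → α ≤ 2 ^ k / k → ∀ c : ℝ, 0 < c → ∀ᶠ n : ℕ in Filter.atTop, ∀ m : ℕ, m = ⌊α * n⌋₊ → ∃ g : (Fin m → Fin k → Fin n × Bool) → (Fin n → Bool), Real.exp (-(c * n)) * Fintype.card (Fin (k + 1) → Fin m → Fin k → Fin n × Bool) ≤ ((Finset.univ.filter fun Ψ : Fin (k + 1) → Fin m → Fin k → Fin n × Bool => let P : Fin k → ℕ → Fin m → Fin k → Fin n × Bool := fun r q a b => if (a : ℕ) * k + b < q then Ψ r.succ a b else Ψ r.castSucc a b; (∀ r : Fin k, ∀ q ≤ m * k, ((Finset.univ.filter fun i : Fin m => ∀ j, g (P r q) (P r q i j).1 ≠ (P r q i j).2).card : ℝ) ≤ ν * m) ∧ ∀ r : Fin k, ∀ q < m * k, (hammingDist (g (P r q)) (g (P r (q + 1))) : ℝ) ≤ η * n).card : ℝ) := by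
  intro η ν hη hν
  obtain ⟨k₀, hk₀⟩ := ssER_exists_k0 ν hν
  refine ⟨k₀, fun k hk α hα _ c hc => ?_⟩
  have hkδ := hk₀ k hk
  -- two eventual conditions on `n`: `ν ⌊α n⌋₊ ≥ 3` and `e^{-cn} ≤ 1/2`
  have hev1 : ∀ᶠ n : ℕ in Filter.atTop, (3 : ℝ) ≤ ν * ⌊α * n⌋₊ := by
    refine Filter.eventually_atTop.2 ⟨⌈(3 / ν + 1) / α⌉₊, fun n hn => ?_⟩
    have hn' : (3 / ν + 1) / α ≤ n := (Nat.ceil_le).1 hn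
    rw [div_le_iff₀ hα] at hn'
    have hfl := Nat.lt_floor_add_one (α * n)
    have h3 : 3 / ν ≤ (⌊α * (n : ℝ)⌋₊ : ℝ) := by linarith
    rw [div_le_iff₀ hν] at h3
    linarith
  have hev2 : ∀ᶠ n : ℕ in Filter.atTop, Real.exp (-(c * n)) ≤ 1 / 2 := by
    refine Filter.eventually_atTop.2 ⟨⌈Real.log 2 / c⌉₊, fun n hn => ?_⟩
    have hn' : Real.log 2 / c ≤ n := (Nat.ceil_le).1 hn
    rw [div_le_iff₀ hc] at hn'
    have h2 : Real.exp (-Real.log 2) = 1 / 2 := by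
      rw [Real.exp_neg, Real.exp_log two_pos, inv_eq_one_div]
    calc Real.exp (-(c * n)) ≤ Real.exp (-Real.log 2) := Real.exp_le_exp.2 (by linarith)
      _ = 1 / 2 := h2
  filter_upwards [hev1, hev2] with n hn1 hn2
  intro m hm
  rw [← hm] at hn1
  have hm0 : 0 < m := by
    rcases Nat.eq_zero_or_pos m with h0 | h0
    · exfalso; rw [h0] at hn1; simp at hn1; linarith
    · exact h0
  have h3 : (1 : ℝ) ≤ ν * m / 3 := by linarith
  refine ⟨fun _ _ => true, ?_⟩
  -- the good product set
  have hgood := ssER_good_paths n k m ν hν hm0 hkδ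
  refine le_trans ?_ (le_trans hgood (Nat.cast_le.2 (Finset.card_le_card fun Ψ hΨ => ?_)))
  · have : (0 : ℝ) ≤ Fintype.card (Fin (k + 1) → Fin m → Fin k → Fin n × Bool) := Nat.cast_nonneg _
    nlinarith
  · have hW := fun ρ => (Finset.mem_filter.1 (Fintype.mem_piFinset.1 hΨ ρ)).2
    refine Finset.mem_filter.2 ⟨Finset.mem_univ _, fun r q _ => ssER_validity Ψ r q ν hW h3,
      fun r q _ => ?_⟩
    simp only [hammingDist_self, Nat.cast_zero]
    positivity

end Summit.PneNP.PneNP.Theorems
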